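import Literature.Analysis.FluidPDE.PerturbedNSFourierLattice
import Literature.Analysis.FluidPDE.FracNSShortTimeExistence
import HarnessLib

/-!
# Fourier-side estimates for the perturbed Navier–Stokes system at the order-four base

Analysis/FluidPDE proof file (theorems only), second of the files `PerturbedNSFourier*` proving
short-time existence of smooth solutions of the perturbed Navier–Stokes system
`∂ₜv + (v·∇)v + (u·∇)v + (v·∇)u + ∇q = νΔv`, `div v = 0`, around a smooth divergence-free
background on `T^d`, `#d ≤ 3`, with a life span controlled by the fourth Sobolev sums of the
datum (Majda–Bertozzi 2002, Thm. 3.4; Cheskidov–Luo 2022, §3.1 (3.2) for the system). The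
symbol of the convective terms is the tree's `CorrectorFourier.convSym U RH c`
(`N(c, cₗ) + N(U, cₗ) + N(c, Uₗ) + ∑ⱼ 2πikⱼ RHₗⱼ`, used downstream with zero stress `RH = 0`),
its Leray projection `CorrectorFourier.projSym` and the pressure coefficients
`CorrectorFourier.presCoef`, whose algebra (`projSym_pressure_identity`,
`sum_intCast_mul_projSym`, `hasDecay_projSym_of_convSym`, `hasDecay_projSym_sub`) is imported.
What `CorrectorFourierEstimates` provides at the summable order `2#d` is redone here at the
order-FOUR base of `PerturbedNSFourierLattice` (mass `Z = ∑ₘ (1+‖m‖)^{-4}`):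

* `summable_weight_four` — for `#d ≤ 3` the order-four weight is summable
  (`GalerkinSmooth.exists_latticeBound`: `∑ (1+|k|²)^{-2} < ∞`, and
  `(1+|m|²)² ≤ (1+#d)²(1+‖m‖)⁴`);
* `hasDecay_convSym_four` — fields and drift of orders `4`, `K + 1` give a symbol of order `K`
  with a constant linear in each top-order constant; `hasDecay_convSym_sub_four` — the
  Lipschitz bound (the difference is a sum of transport symbols with exactly one slot carrying
  `c - c'`, `convSym_sub_four`);
* `continuous_projSym_param_four` — continuity in a parameter;
* `projSym_zero_freq_four` — the projected symbol vanishes at `k = 0` when drift and field are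
  Fourier-divergence free (zero spatial mean is preserved; Cheskidov–Luo 2022, §3.1).

## References

* A. J. Majda, A. L. Bertozzi, *Vorticity and Incompressible Flow*, CUP 2002, Thm. 3.4. [`MajdaBertozziCUP2002`]
* A. Cheskidov, X. Luo, *Sharp nonuniqueness for the Navier–Stokes equations*, Invent. Math. 229
  (2022), §3.1 (3.2). [`CheskidovLuo2022`]
* P. G. Lemarié-Rieusset, *The Navier–Stokes problem in the 21st century*, CRC 2016, §6.1, §8.5.
-/

noncomputable section

open MeasureTheory Real Set Filter Topology UnitAddTorus

namespace Literature.Analysis.FluidPDE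

namespace PerturbedNSFourier

open ScalarFourier
open CorrectorFourier (leraySym convSym convSym_apply projSym projSym_apply norm_leraySym_le
  sum_dsym_mul_eq_zero)
open FourierNS (HasDecay)
open Literature.Analysis.FunctionSpaces.Torus (freqNormSq)

variable {d : Type*} [Fintype d] {Z : ℝ}

/-! ### The order-four mass in dimension at most three -/

section Mass

/-- `(1 + |m|²)² ≤ (1 + #d)² (1 + ‖m‖)⁴` (Euclidean length against sup norm). [folklore] -/
theorem one_add_freqNormSq_sq_le (m : d → ℤ) :
    (1 + freqNormSq m) ^ 2 ≤ (1 + (Fintype.card d : ℝ)) ^ 2 * (1 + ‖m‖) ^ 4 := by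
  have hc : (0 : ℝ) ≤ Fintype.card d := Nat.cast_nonneg _
  have h0 : 0 ≤ ‖m‖ := norm_nonneg m
  have h1 : 1 + freqNormSq m ≤ (1 + Fintype.card d) * (1 + ‖m‖) ^ 2 := by
    have := freqNormSq_le_card_mul m
    nlinarith
  have h2 : 0 ≤ 1 + freqNormSq m := by linarith [FunctionSpaces.Torus.freqNormSq_nonneg m]
  calc (1 + freqNormSq m) ^ 2 ≤ ((1 + Fintype.card d) * (1 + ‖m‖) ^ 2) ^ 2 := pow_le_pow_left₀ h2 h1 2
    _ = (1 + (Fintype.card d : ℝ)) ^ 2 * (1 + ‖m‖) ^ 4 := by ring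

/-- **For `#d ≤ 3` the order-four weight is summable on `ℤ^d`**: `∑ₘ (1 + ‖m‖)^{-4} < ∞`
(comparison with `∑ₖ (1 + |k|²)^{-2} < ∞`, `GalerkinSmooth.exists_latticeBound`). [folklore] -/
theorem summable_weight_four (hd : Fintype.card d ≤ 3) :
    Summable fun m : d → ℤ => ((1 + ‖m‖) ^ 4)⁻¹ := by
  obtain ⟨B, hB⟩ := GalerkinSmooth.exists_latticeBound (d := d) hd
  have hs : Summable fun k : d → ℤ => ((1 + freqNormSq k) ^ 2)⁻¹ :=
    summable_of_sum_le (fun k => by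
      have := FunctionSpaces.Torus.freqNormSq_nonneg k
      positivity) hB
  refine Summable.of_nonneg_of_le (fun m => by positivity) (fun m => ?_)
    (hs.mul_left ((1 + (Fintype.card d : ℝ)) ^ 2))
  have hpos : 0 < (1 + freqNormSq m) ^ 2 :=
    pow_pos (by linarith [FunctionSpaces.Torus.freqNormSq_nonneg m]) _
  have hpos' : 0 < (1 + ‖m‖) ^ 4 := by positivity
  rw [← div_eq_mul_inv, le_div_iff₀ hpos, inv_mul_eq_div, div_le_iff₀ hpos']
  exact one_add_freqNormSq_sq_le m

/-- The order-four mass `Z = ∑ₘ (1 + ‖m‖)^{-4}` for `#d ≤ 3`. [folklore] -/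
theorem hasSum_weight_four (hd : Fintype.card d ≤ 3) :
    HasSum (fun m : d → ℤ => ((1 + ‖m‖) ^ 4)⁻¹) (∑' m : d → ℤ, ((1 + ‖m‖) ^ 4)⁻¹) :=
  (summable_weight_four hd).hasSum

end Mass

variable [DecidableEq d]

/-! ### Decay of the symbols -/

section Decay

variable {K : ℕ} {A₄ A X₄ X B : ℝ} {U : d → (d → ℤ) → ℂ} {RH : d → d → (d → ℤ) → ℂ}
  {c : d → (d → ℤ) → ℂ}

omit [DecidableEq d] in
/-- **Decay of the convective symbol at the order-four base.** If the velocity coefficients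
decay to orders `4` (constant `X₄`) and `K + 1` (constant `X`), the drift coefficients to the
same orders (constants `A₄`, `A`) and the stress coefficients to order `K + 1` (constant `B`),
then `convSym` decays to order `K` with the constant
`T(X,X₄;X,X₄) + T(A,A₄;X,X₄) + T(X,X₄;A,A₄) + #d·2πB`, `T(A,A₄;X,X₄) = #d 2ᴷ Z (A·2πX₄ + A₄·2πX)`
— linear in each top-order constant (`hasDecay_transportSym_four`). [folklore] -/
theorem hasDecay_convSym_four (hZ : HasSum (fun m : d → ℤ => ((1 + ‖m‖) ^ 4)⁻¹) Z)
    (hA : 0 ≤ A) (hX : 0 ≤ X)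
    (hU₄ : ∀ j, HasDecay 4 A₄ (U j)) (hU : ∀ j, HasDecay (K + 1) A (U j))
    (hc₄ : ∀ j, HasDecay 4 X₄ (c j)) (hc : ∀ j, HasDecay (K + 1) X (c j))
    (hR : ∀ i j, HasDecay (K + 1) B (RH i j)) (l : d) :
    HasDecay K
      (Fintype.card d * (2 ^ K * Z * (X * (2 * π * X₄) + X₄ * (2 * π * X))) +
        Fintype.card d * (2 ^ K * Z * (A * (2 * π * X₄) + A₄ * (2 * π * X))) +
        Fintype.card d * (2 ^ K * Z * (X * (2 * π * A₄) + X₄ * (2 * π * A))) +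
        Fintype.card d * (2 * π * B))
      (convSym U RH c l) := by
  have h1 : HasDecay K (Fintype.card d * (2 ^ K * Z * (X * (2 * π * X₄) + X₄ * (2 * π * X))))
      (transportSym c (c l)) :=
    hasDecay_transportSym_four hZ hc₄ hc hX (hc₄ l) (hc l) hX
  have h2 : HasDecay K (Fintype.card d * (2 ^ K * Z * (A * (2 * π * X₄) + A₄ * (2 * π * X))))
      (transportSym U (c l)) :=
    hasDecay_transportSym_four hZ hU₄ hU hA (hc₄ l) (hc l) hX
  have h3 : HasDecay K (Fintype.card d * (2 ^ K * Z * (X * (2 * π * A₄) + X₄ * (2 * π * A))))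
      (transportSym c (U l)) :=
    hasDecay_transportSym_four hZ hc₄ hc hX (hU₄ l) (hU l) hA
  have h4 := CorrectorFourier.hasDecay_forcing hR l
  intro k
  rw [convSym_apply]
  exact norm_add_le_of_le (norm_add_le_of_le (norm_add_le_of_le (h1 k) (h2 k)) (h3 k)) (h4 k)
    |>.trans (le_of_eq (by ring))

end Decay

/-! ### Linearity and Lipschitz bounds in the velocity coefficients -/

section Lipschitz

variable {K : ℕ} {A₄ A X₄ X B : ℝ} {U : d → (d → ℤ) → ℂ} {RH : d → d → (d → ℤ) → ℂ}
  {c c' : d → (d → ℤ) → ℂ}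

omit [DecidableEq d] in
/-- **The convective symbol is affine-quadratic in the velocity coefficients** (order-four
data): `G(c) - G(c') = N(c, cₗ - c'ₗ) + N(c - c', c'ₗ) + N(U, cₗ - c'ₗ) + N(c - c', Uₗ)`. [folklore] -/
theorem convSym_sub_four (hZ : HasSum (fun m : d → ℤ => ((1 + ‖m‖) ^ 4)⁻¹) Z) {X₁ X₂ : ℝ}
    (hU : ∀ j, HasDecay 4 A₄ (U j)) (hc : ∀ j, HasDecay 4 X₁ (c j)) (hc' : ∀ j, HasDecay 4 X₂ (c' j))
    (l : d) (k : d → ℤ) :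
    convSym U RH c l k - convSym U RH c' l k =
      transportSym c (fun m => c l m - c' l m) k + transportSym (fun j m => c j m - c' j m) (c' l) k +
        transportSym U (fun m => c l m - c' l m) k +
        transportSym (fun j m => c j m - c' j m) (U l) k := by
  rw [convSym_apply, convSym_apply]
  have h1 : transportSym c (c l) k - transportSym c' (c' l) k =
      transportSym c (fun m => c l m - c' l m) k + transportSym (fun j m => c j m - c' j m) (c' l) k := by
    have e1 := transportSym_sub_four hZ (U := c) hc (hc l) (hc' l) k
    have e2 := transportSym_sub_left_four hZ (c₀ := c' l) hc hc' (hc' l) k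
    linear_combination e1 + e2
  have h2 := transportSym_sub_four hZ (U := U) hU (hc l) (hc' l) k
  have h3 := transportSym_sub_left_four hZ (c₀ := U l) hc hc' (hU l) k
  linear_combination h1 + h2 + h3

omit [DecidableEq d] in
/-- **Lipschitz bound for the convective symbol at the order-four base.** With `c`, `c'`
decaying to orders `4`, `K + 1` (constants `X₄`, `X`; `X₄'`, `X'`), `U` likewise (`A₄`, `A`),
and the difference `e = c - c'` to orders `4` (`E₄`) and `K + 1` (`E`), the difference
`G(c) - G(c')` decays to order `K` with a constant linear in `(E₄, E)`. [folklore] -/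
theorem hasDecay_convSym_sub_four (hZ : HasSum (fun m : d → ℤ => ((1 + ‖m‖) ^ 4)⁻¹) Z)
    {X₄' X' E₄ E : ℝ} (hA : 0 ≤ A) (hX : 0 ≤ X) (hX' : 0 ≤ X') (hE : 0 ≤ E)
    (hU₄ : ∀ j, HasDecay 4 A₄ (U j)) (hU : ∀ j, HasDecay (K + 1) A (U j))
    (hc₄ : ∀ j, HasDecay 4 X₄ (c j)) (hc : ∀ j, HasDecay (K + 1) X (c j))
    (hc'₄ : ∀ j, HasDecay 4 X₄' (c' j)) (hc' : ∀ j, HasDecay (K + 1) X' (c' j))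
    (he₄ : ∀ j, HasDecay 4 E₄ (fun m => c j m - c' j m))
    (he : ∀ j, HasDecay (K + 1) E (fun m => c j m - c' j m)) (l : d) :
    HasDecay K
      (Fintype.card d * (2 ^ K * Z * (X * (2 * π * E₄) + X₄ * (2 * π * E))) +
        Fintype.card d * (2 ^ K * Z * (E * (2 * π * X₄') + E₄ * (2 * π * X'))) +
        Fintype.card d * (2 ^ K * Z * (A * (2 * π * E₄) + A₄ * (2 * π * E))) +
        Fintype.card d * (2 ^ K * Z * (E * (2 * π * A₄) + E₄ * (2 * π * A))))
      (fun k => convSym U RH c l k - convSym U RH c' l k) := by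
  have h1 : HasDecay K (Fintype.card d * (2 ^ K * Z * (X * (2 * π * E₄) + X₄ * (2 * π * E))))
      (transportSym c (fun m => c l m - c' l m)) :=
    hasDecay_transportSym_four hZ hc₄ hc hX (he₄ l) (he l) hE
  have h2 : HasDecay K (Fintype.card d * (2 ^ K * Z * (E * (2 * π * X₄') + E₄ * (2 * π * X'))))
      (transportSym (fun j m => c j m - c' j m) (c' l)) :=
    hasDecay_transportSym_four hZ he₄ he hE (hc'₄ l) (hc' l) hX'
  have h3 : HasDecay K (Fintype.card d * (2 ^ K * Z * (A * (2 * π * E₄) + A₄ * (2 * π * E))))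
      (transportSym U (fun m => c l m - c' l m)) :=
    hasDecay_transportSym_four hZ hU₄ hU hA (he₄ l) (he l) hE
  have h4 : HasDecay K (Fintype.card d * (2 ^ K * Z * (E * (2 * π * A₄) + E₄ * (2 * π * A))))
      (transportSym (fun j m => c j m - c' j m) (U l)) :=
    hasDecay_transportSym_four hZ he₄ he hE (hU₄ l) (hU l) hA
  intro k
  change ‖convSym U RH c l k - convSym U RH c' l k‖ ≤ _
  rw [convSym_sub_four hZ hU₄ hc₄ hc'₄ l k]
  exact (norm_add_le_of_le (norm_add_le_of_le (norm_add_le_of_le (h1 k) (h2 k)) (h3 k)) (h4 k)).trans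
    (le_of_eq (by ring))

end Lipschitz

/-! ### Continuity in a parameter -/

section Continuity

variable {Y : Type*} [TopologicalSpace Y] {A X : ℝ}

omit [DecidableEq d] in
/-- Continuity in a parameter of the convective symbol (continuous fields with uniform decay
of order four). [folklore] -/
theorem continuous_convSym_param_four (hZ : HasSum (fun m : d → ℤ => ((1 + ‖m‖) ^ 4)⁻¹) Z)
    {U : Y → d → (d → ℤ) → ℂ} {RH : Y → d → d → (d → ℤ) → ℂ}
    {c : Y → d → (d → ℤ) → ℂ} (hU : ∀ j m, Continuous fun y => U y j m)
    (hR : ∀ i j m, Continuous fun y => RH y i j m) (hc : ∀ j m, Continuous fun y => c y j m)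
    (hUd : ∀ y j, HasDecay 4 A (U y j)) (hcd : ∀ y j, HasDecay 4 X (c y j))
    (l : d) (k : d → ℤ) : Continuous fun y => convSym (U y) (RH y) (c y) l k := by
  simp only [convSym_apply]
  refine ((Continuous.add ?_ ?_).add ?_).add ?_
  · exact continuous_transportSym_param_four hZ (U := fun y => c y) (c := fun y => c y l) hc (hc l)
      hcd (fun y => hcd y l) k
  · exact continuous_transportSym_param_four hZ (U := fun y => U y) (c := fun y => c y l) hU (hc l)
      hUd (fun y => hcd y l) k
  · exact continuous_transportSym_param_four hZ (U := fun y => c y) (c := fun y => U y l) hc (hU l)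
      hcd (fun y => hUd y l) k
  · exact continuous_finsetSum _ fun j _ => continuous_const.mul (hR l j k)

/-- Continuity in a parameter of the projected symbol (order-four data). [folklore] -/
theorem continuous_projSym_param_four (hZ : HasSum (fun m : d → ℤ => ((1 + ‖m‖) ^ 4)⁻¹) Z)
    {U : Y → d → (d → ℤ) → ℂ} {RH : Y → d → d → (d → ℤ) → ℂ}
    {c : Y → d → (d → ℤ) → ℂ} (hU : ∀ j m, Continuous fun y => U y j m)
    (hR : ∀ i j m, Continuous fun y => RH y i j m) (hc : ∀ j m, Continuous fun y => c y j m)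
    (hUd : ∀ y j, HasDecay 4 A (U y j)) (hcd : ∀ y j, HasDecay 4 X (c y j))
    (l : d) (k : d → ℤ) : Continuous fun y => projSym (U y) (RH y) (c y) l k := by
  simp only [projSym_apply]
  exact continuous_finsetSum _ fun m _ =>
    continuous_const.mul (continuous_convSym_param_four hZ hU hR hc hUd hcd m k)

end Continuity

/-! ### The zero mode -/

section ZeroMode

variable {A X : ℝ} {U : d → (d → ℤ) → ℂ} {RH : d → d → (d → ℤ) → ℂ} {c : d → (d → ℤ) → ℂ}

omit [DecidableEq d] in
/-- **The convective symbol vanishes at the zero frequency** when both the drift and the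
velocity coefficients (of order four) are Fourier-divergence free (the three transport symbols
vanish, `transportSym_zero_of_divFree_four`, and the forcing symbol `2πi·0ⱼ` vanishes):
the zero spatial mean is preserved (Cheskidov–Luo 2022, §3.1). [folklore] -/
theorem convSym_zero_freq_four (hZ : HasSum (fun m : d → ℤ => ((1 + ‖m‖) ^ 4)⁻¹) Z)
    (hU : ∀ j, HasDecay 4 A (U j)) (hc : ∀ j, HasDecay 4 X (c j))
    (hUdiv : ∀ m, ∑ j, (m j : ℂ) * U j m = 0) (hcdiv : ∀ m, ∑ j, (m j : ℂ) * c j m = 0) (l : d) :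
    convSym U RH c l 0 = 0 := by
  rw [convSym_apply, transportSym_zero_of_divFree_four hZ hc (hc l) (sum_dsym_mul_eq_zero hcdiv),
    transportSym_zero_of_divFree_four hZ hU (hc l) (sum_dsym_mul_eq_zero hUdiv),
    transportSym_zero_of_divFree_four hZ hc (hU l) (sum_dsym_mul_eq_zero hcdiv)]
  simp [dsym_apply]

/-- The projected symbol vanishes at the zero frequency under the same hypotheses. [folklore] -/
theorem projSym_zero_freq_four (hZ : HasSum (fun m : d → ℤ => ((1 + ‖m‖) ^ 4)⁻¹) Z)
    (hU : ∀ j, HasDecay 4 A (U j)) (hc : ∀ j, HasDecay 4 X (c j))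
    (hUdiv : ∀ m, ∑ j, (m j : ℂ) * U j m = 0) (hcdiv : ∀ m, ∑ j, (m j : ℂ) * c j m = 0) (l : d) :
    projSym U RH c l 0 = 0 := by
  rw [projSym_apply]
  simp_rw [convSym_zero_freq_four hZ hU hc hUdiv hcdiv, mul_zero, Finset.sum_const_zero]

end ZeroMode

end PerturbedNSFourier

end Literature.Analysis.FluidPDE

end
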